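/-
COR-CM (cell pub-hodgecm2, stage 2 of the Hodge ladder) — count-neutral KERNEL COMBINATORICS «the octic product column G = Q₈ × B, D₄ × B: THE LAW μ = φ₂ over cyclic
B = ℤ/m, m odd ≥ 3 (= β resp. β − 2)» (seat prover-pub-hodgecm2-b23-g45-0, binder prover b23, gen 45; own census lane OCTIC-PRODUCT, claim HOME/INBOX.md l.18829).  Theorems only,
on `Census/OcticProductLaw.lean` and gen 44ʼs slot datum of `ℤ/m` (`Census/QuarticInversionCyclic.exists_slot_datum`) BY NAME; no `decide`, no certificate, no
named fact, no `sorry`.  `Interfaces.lean` (C1), every E term, B01, `Transposition/*`, `PortJoin/*`, `D2Bridge/*` untouched.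
HONEST FRAMING: `HC_CM` is NOT proved, here or anywhere in the tree; nothing here is a period, a count of record or a headline.
T5: n/a-class (hypothesis binders = the datum equations only); checker: self, 2026-08-24.
-/
import Summits.HodgeConjecture.CorCM.Census.OcticProductLaw
import Summits.HodgeConjecture.CorCM.Census.OcticProductBlockCount
import Summits.HodgeConjecture.CorCM.Census.QuarticInversionCyclic

/-!
# THE OCTIC PRODUCT LAW over cyclic `B = ℤ/m`, `m` odd `≥ 3`: `μ = φ₂`, i.e. `μ(Q₈ × ℤ/m) = β` and `μ(D₄ × ℤ/m) = β − 2`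

For every finite group `G` with a central involution `c` carrying an octic product datum `D : Datum G c (ℤ/m) ζ` (`Census/OcticProductDictionary.lean`:
`G ≅ Q₈ × ℤ/m` with `c = (−1, 0)` for `ζ = 1`, `G ≅ D₄ × ℤ/m` with `c = (r², 0)` for `ζ = 0`; degree `8m` as a Galois CM type: a quaternion resp.
dihedral Galois CM octic field composed with a totally real cyclic field of odd degree `m`), `m` odd `≥ 3`:
* **`isLeast_card_gfaces_generate_cyclic`: `μ(G, c) = φ₂(G, c)`** (both `ζ` at once) — the least number of abstract rank-four face relations whose
  base changes, together with the pairs, span the integer Hodge lattice `hodgeSpan c` is EXACTLY the coinvariant fibre: b09ʼs floor is attained;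
* in the block currency, writing `m = 2k + 1`: **`isLeast_card_gfaces_generate_cyclic_one`: `μ = β`** (`ζ = 1`; e.g. `Q₈ × ℤ/3`: `β = 172`,
  lit-andre-3ʼs row `Census/TwentyFourC3Q8*`) and **`isLeast_card_gfaces_generate_cyclic_zero`: `μ = β − 2`** (`ζ = 0`; e.g. `D₄ × ℤ/3`:
  `β = 184`, EXACTLY `182`), by `β = φ₂` resp. `β = φ₂ + 2` (`Census/OcticProductStabiliser.lean`; `m` odd ⇒ no element of order `4`).
The rows `m = 3` with the block counts of `Census/OcticProductBlockCount.lean`: **`Q₈ × ℤ/3`: EXACTLY `172`** (`isLeast_card_gfaces_generate_oneHundredSeventyTwo`),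
**`D₄ × ℤ/3`: EXACTLY `182`** (`isLeast_card_gfaces_generate_oneHundredEightyTwo`; `β = 184`).  The slot datum and the cross datum of `ℤ/m` are gen 44ʼs
(`Census/QuarticInversionCyclic.exists_slot_datum`).  `HC_CM` is NOT proved; nothing here is a
period.  All [folklore] (Pohlmann [Pohlmann1968, Thm 1]).

## References
* [Pohlmann1968] H. Pohlmann, Algebraic cycles on abelian varieties of complex multiplication type, Ann. of Math. 88 (1968), Thm 1.
* [Milne1999] J. S. Milne, Lefschetz motives and the Tate conjecture, Compositio Math. 117 (1999), Prop. 2.1, p. 54.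
-/

namespace Summit.HodgeConjecture.CorCM.Census.OcticProduct

open Finset
open Summit.HodgeConjecture.CorCM.Prior.AllgGroup.RfwfAllgGroup
open Summit.HodgeConjecture.CorCM.Census.BlockParity
open Summit.HodgeConjecture.CorCM.Census.Coinvariant
open Summit.HodgeConjecture.CorCM.Census.QuarticInversion (exists_slot_datum)

noncomputable section

section Laws

variable {G : Type*} [Group G] [Fintype G] [DecidableEq G] {c : G}

/-- **THE LAW `μ = φ₂` over `ℤ/m`** (`m` odd `≥ 3`; any `(G, c)` carrying an octic product datum of either square class over `ℤ/m`). [folklore] -/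
theorem isLeast_card_gfaces_generate_cyclic {m : ℕ} [NeZero m] {ζ : ZMod 2} (D : Datum G c (ZMod m) ζ) (hc2 : c * c = 1) (hm : Odd m)
    (h3 : 3 ≤ m) :
    IsLeast {n : ℕ | ∃ S : Finset (CMF G c →₀ ℤ), ↑S ⊆ gfaceSet G c hc2 ∧ S.card = n ∧
      hodgeSpan c hc2 ≤ Submodule.span ℤ (pairSet c) ⊔ Submodule.span ℤ (translates c S)} (fibreTwo c hc2) :=
  isLeast_card_gfaces_generate D hc2 (by rw [ZMod.card]; exact hm) (by rw [ZMod.card]; exact h3) (exists_slot_datum m hm h3)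

/-- **THE LAW `μ(Q₈ × ℤ/(2k+1)) = β`** (`k ≥ 1`; any `(G, c)` carrying an octic product datum of square class `1` over `ℤ/(2k+1)`). [folklore] -/
theorem isLeast_card_gfaces_generate_cyclic_one {k : ℕ} (D : Datum G c (ZMod (2 * k + 1)) 1) (hc2 : c * c = 1) (hk : 1 ≤ k) :
    IsLeast {n : ℕ | ∃ S : Finset (CMF G c →₀ ℤ), ↑S ⊆ gfaceSet G c hc2 ∧ S.card = n ∧
      hodgeSpan c hc2 ≤ Submodule.span ℤ (pairSet c) ⊔ Submodule.span ℤ (translates c S)} (Fintype.card (BlockParity.Block c)) := by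
  have hA : Odd (Fintype.card (ZMod (2 * k + 1))) := by rw [ZMod.card]; exact ⟨k, rfl⟩
  rw [card_block_eq_fibreTwo_of_one D (ClockTypes.not_four_dvd_addOrderOf_of_odd hA) hc2]
  exact isLeast_card_gfaces_generate_cyclic D hc2 ⟨k, rfl⟩ (by omega)

/-- **THE LAW `μ(D₄ × ℤ/(2k+1)) = β − 2`** (`k ≥ 1`; any `(G, c)` carrying an octic product datum of square class `0` over `ℤ/(2k+1)`). [folklore] -/
theorem isLeast_card_gfaces_generate_cyclic_zero {k : ℕ} (D : Datum G c (ZMod (2 * k + 1)) 0) (hc2 : c * c = 1) (hk : 1 ≤ k) :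
    IsLeast {n : ℕ | ∃ S : Finset (CMF G c →₀ ℤ), ↑S ⊆ gfaceSet G c hc2 ∧ S.card = n ∧
      hodgeSpan c hc2 ≤ Submodule.span ℤ (pairSet c) ⊔ Submodule.span ℤ (translates c S)} (Fintype.card (BlockParity.Block c) - 2) := by
  rw [card_block_eq_fibreTwo_add_two_of_zero D hc2, Nat.add_sub_cancel]
  exact isLeast_card_gfaces_generate_cyclic D hc2 ⟨k, rfl⟩ (by omega)

/-- **Row `Q₈ × ℤ/3` (order `24`, `ζ = 1`): EXACTLY `172` faces** (`β = 172`; lit-andre-3ʼs `Census/TwentyFourC3Q8*` in the uniform currency). [folklore] -/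
theorem isLeast_card_gfaces_generate_oneHundredSeventyTwo (D : Datum G c (ZMod 3) 1) (hc2 : c * c = 1) :
    IsLeast {n : ℕ | ∃ S : Finset (CMF G c →₀ ℤ), ↑S ⊆ gfaceSet G c hc2 ∧ S.card = n ∧
      hodgeSpan c hc2 ≤ Submodule.span ℤ (pairSet c) ⊔ Submodule.span ℤ (translates c S)} 172 := by
  have h := isLeast_card_gfaces_generate_cyclic_one (k := 1) D hc2 le_rfl
  rwa [card_block_eq_oneHundredSeventyTwo D hc2] at h

/-- **Row `D₄ × ℤ/3` with `c = (r², 0)` (order `24`, `ζ = 0`): EXACTLY `182` faces** (`β = 184`; a NEW atlas row). [folklore] -/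
theorem isLeast_card_gfaces_generate_oneHundredEightyTwo (D : Datum G c (ZMod 3) 0) (hc2 : c * c = 1) :
    IsLeast {n : ℕ | ∃ S : Finset (CMF G c →₀ ℤ), ↑S ⊆ gfaceSet G c hc2 ∧ S.card = n ∧
      hodgeSpan c hc2 ≤ Submodule.span ℤ (pairSet c) ⊔ Submodule.span ℤ (translates c S)} 182 := by
  have h := isLeast_card_gfaces_generate_cyclic_zero (k := 1) D hc2 le_rfl
  rwa [card_block_eq_oneHundredEightyFour D hc2] at h

end Laws

end

end Summit.HodgeConjecture.CorCM.Census.OcticProduct
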